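import Summits.ValiantsHypothesis.ValiantsHypothesis.Theorems.KPlusLogSqLawTropicalBToeplitzMorphRank
import Summits.ValiantsHypothesis.ValiantsHypothesis.Theorems.KPlusLogSqLawTropicalBToeplitzMorphTight
import Summits.ValiantsHypothesis.ValiantsHypothesis.Theorems.KPlusLogSqLawTropicalBToeplitzMorphDuality

/-!
# Route `KPlusLogSqLaw`, crux `TropicalB` — Toeplitz sector: THE MORPH THEOREM (odd members) — `μ_j` is the unique optimum of the pencil

HONEST FRAMING.  Helper toward the registered stubs `stub_tropThin` / `stub_tropFat` (crux `…Theses.KPlusLogSqLaw.TropicalB`, item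
`stmt-ValiantsHypothesis-19771`; cell `pub-symmetroid`, seat `val-sym-trop-p4` (g23), 2026-08-29).  THE MORPH THEOREM of the memos
HOME/val-sym-trop-p4/g22/DOUBLING-g22.md §2c and g23/MORPH-THEOREM-g23.md, for the odd members: for every `q ≥ 2h + 2` there is a
permutation `τ` of `Fin (2q+2q)` (the morph member `μ_j`, `j = 2h+1`, sign string `U^q D^{q−j} (UD)^j U^{q−j} D^q`) which is the UNIQUE
maximiser of the parameter-free pencil objective `Σ_b |σ b − b|·(K − 2|σ b − b|)`, `K = 4q + 2j + 1 = 4q + 4h + 3`, over all permutations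
`σ` (`morph_member`).  Proof = closed-form LP dual (`…MorphFeasibleSame/Opp`, `…MorphRank`, `…MorphTight`) + weak duality with a rank
function (`…MorphDuality`); the statement is definition-free (the member is exhibited inside the proof) and also records `τ (q−1) = 2q+2h`
(the members are pairwise distinct) and `τ q = 0` (the member is not bipartite).  CONSEQUENCE (next file `…ToeplitzDoublingMorph`): the
doubling law with `⌊n/4⌋` extra bottom-phase members, hence super-linearity of `Φ_Q` and `¬ConjectureQ`, `¬ConjectureTLinear`.
Nothing here bounds `Φ_Toep` from above; `ConjectureTPoly` / `TropicalB` stay OPEN; nothing on `MatrixDescartes` or `VP ≠ VNP`.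
-/

set_option linter.dupNamespace false
set_option autoImplicit false

namespace Summit.ValiantsHypothesis.ValiantsHypothesis.Theorems.KPlusLogSqLaw.Toeplitz

open scoped BigOperators
open Finset

set_option maxHeartbeats 4000000 in
/-- **THE MORPH THEOREM (odd members).**  For `q ≥ 2h+2` there is a permutation `τ` of `Fin (2q+2q)` — the morph member `μ_{2h+1}` — with
`τ (q−1) = 2q+2h`, `τ q = 0`, and such that every other permutation `σ` has a strictly smaller pencil value
`Σ_b |σ b − b|·(4q+4h+3 − 2|σ b − b|)`. [folklore] -/
theorem morph_member (q h : ℕ) (hq : 2 * h + 2 ≤ q) :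
    ∃ τ : Equiv.Perm (Fin (2 * q + 2 * q)),
      ((τ ⟨q - 1, by omega⟩ : Fin (2 * q + 2 * q)) : ℕ) = 2 * q + 2 * h ∧
      ((τ ⟨q, by omega⟩ : Fin (2 * q + 2 * q)) : ℕ) = 0 ∧
      ∀ σ : Equiv.Perm (Fin (2 * q + 2 * q)), σ ≠ τ →
        ∑ b : Fin (2 * q + 2 * q), |((σ b : Fin (2 * q + 2 * q)) : ℤ) - (b : ℤ)| *
            ((4 * q + 4 * h + 3 : ℤ) - 2 * |((σ b : Fin (2 * q + 2 * q)) : ℤ) - (b : ℤ)|) <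
        ∑ b : Fin (2 * q + 2 * q), |((τ b : Fin (2 * q + 2 * q)) : ℤ) - (b : ℤ)| *
            ((4 * q + 4 * h + 3 : ℤ) - 2 * |((τ b : Fin (2 * q + 2 * q)) : ℤ) - (b : ℤ)|) := by
  have hqz : 2 * (h:ℤ) + 2 ≤ (q:ℤ) := by exact_mod_cast hq
  have hhz : (0:ℤ) ≤ (h:ℤ) := by positivity
  -- the closed-form dual potential, the coordinate, and the morph involution (integer versions)
  set f : ℤ → ℤ := fun x : ℤ => if x ≤ 2 * (h:ℤ) then x ^ 2 else if x ≤ (q:ℤ) - 1 then (4)*(h:ℤ)*x + (-4)*(h:ℤ)^2 + (-2)*(h:ℤ) + (1)*x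
      else if x ≤ (q:ℤ) + (h:ℤ) then (4)*(h:ℤ)*x + (-4)*(h:ℤ)^2 + (4)*(q:ℤ)*x + (-2)*(q:ℤ)^2 + (-2)*x^2 + (-2)*(h:ℤ) + (2)*(q:ℤ) + (-1)*x
      else if x ≤ (q:ℤ) + 2 * (h:ℤ) + 1 then (4)*(h:ℤ)*x + (-4)*(h:ℤ)^2 + (4)*(q:ℤ)*x + (-2)*(q:ℤ)^2 + (-2)*x^2 + (-6)*(h:ℤ) + (-2)*(q:ℤ) + (3)*x + (-1)
      else (8)*(h:ℤ)*(q:ℤ) + (-4)*(h:ℤ)*x + (4)*(h:ℤ)^2 + (2)*(h:ℤ) + (2)*(q:ℤ) + (-1)*x + (1) with hf_def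
  set X : ℤ → ℤ := fun p : ℤ => if p ≤ 2 * (q:ℤ) - 1 then 2 * (q:ℤ) - 1 - p else p - 2 * (q:ℤ) with hX_def
  set g : ℤ → ℤ := fun p : ℤ => if p ≤ (q:ℤ) - 2 * (h:ℤ) - 2 then p + (q:ℤ) else if p ≤ (q:ℤ) - 1 then 2 * p + 2 * (h:ℤ) + 2
      else if p ≤ 2 * (q:ℤ) - 2 * (h:ℤ) - 2 then p - (q:ℤ)
      else if p ≤ 2 * (q:ℤ) - 1 then (if (2 * (q:ℤ) - 1 - p) % 2 = 0 then 3 * (q:ℤ) + (h:ℤ) - (2 * (q:ℤ) - 1 - p) / 2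
        else (q:ℤ) - (h:ℤ) - 2 - (2 * (q:ℤ) - 2 - p) / 2)
      else if p ≤ 2 * (q:ℤ) + 2 * (h:ℤ) then (if (p - 2 * (q:ℤ)) % 2 = 0 then (q:ℤ) - (h:ℤ) - 1 + (p - 2 * (q:ℤ)) / 2
        else 3 * (q:ℤ) + (h:ℤ) + 1 + (p - 2 * (q:ℤ) - 1) / 2)
      else if p ≤ 3 * (q:ℤ) - 1 then p + (q:ℤ)
      else if p ≤ 3 * (q:ℤ) + 2 * (h:ℤ) + 1 then 2 * p - 4 * (q:ℤ) - 2 * (h:ℤ) - 1 else p - (q:ℤ) with hg_def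
  have hf1e : ∀ t : ℤ, 0 ≤ t → t ≤ (h:ℤ) → f (2 * t) = (4)*t^2 := by
    intros; simp only [hf_def]; split_ifs
    all_goals first | ring1 | (exfalso; omega)
  have hf1o : ∀ t : ℤ, 0 ≤ t → t + 1 ≤ (h:ℤ) → f (2 * t + 1) = (4)*t^2 + (4)*t + (1) := by
    intros; simp only [hf_def]; split_ifs
    all_goals first | ring1 | (exfalso; omega)
  have hf2 : ∀ x : ℤ, 2 * (h:ℤ) + 1 ≤ x → x ≤ (q:ℤ) - 1 → f x = (4)*(h:ℤ)*x + (-4)*(h:ℤ)^2 + (-2)*(h:ℤ) + (1)*x := by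
    intros; simp only [hf_def]; split_ifs
    all_goals first | ring1 | (exfalso; omega)
  have hf3 : ∀ x : ℤ, (q:ℤ) ≤ x → x ≤ (q:ℤ) + (h:ℤ) → f x = (4)*(h:ℤ)*x + (-4)*(h:ℤ)^2 + (4)*(q:ℤ)*x + (-2)*(q:ℤ)^2 + (-2)*x^2 + (-2)*(h:ℤ) + (2)*(q:ℤ) + (-1)*x := by
    intros; simp only [hf_def]; split_ifs
    all_goals first | ring1 | (exfalso; omega)
  have hf4 : ∀ x : ℤ, (q:ℤ) + (h:ℤ) + 1 ≤ x → x ≤ (q:ℤ) + 2 * (h:ℤ) + 1 → f x = (4)*(h:ℤ)*x + (-4)*(h:ℤ)^2 + (4)*(q:ℤ)*x + (-2)*(q:ℤ)^2 + (-2)*x^2 + (-6)*(h:ℤ) + (-2)*(q:ℤ) + (3)*x + (-1) := by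
    intros; simp only [hf_def]; split_ifs
    all_goals first | ring1 | (exfalso; omega)
  have hf5 : ∀ x : ℤ, (q:ℤ) + 2 * (h:ℤ) + 2 ≤ x → x ≤ 2 * (q:ℤ) - 1 → f x = (8)*(h:ℤ)*(q:ℤ) + (-4)*(h:ℤ)*x + (4)*(h:ℤ)^2 + (2)*(h:ℤ) + (2)*(q:ℤ) + (-1)*x + (1) := by
    intros; simp only [hf_def]; split_ifs
    all_goals first | ring1 | (exfalso; omega)
  have hxL : ∀ p : ℤ, 0 ≤ p → p ≤ 2 * (q:ℤ) - 1 → X p = 2 * (q:ℤ) - 1 - p := by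
    intro p h0 h1; simp only [hX_def]; rw [if_pos h1]
  have hxR : ∀ p : ℤ, 2 * (q:ℤ) ≤ p → p ≤ 4 * (q:ℤ) - 1 → X p = p - 2 * (q:ℤ) := by
    intro p h0 h1; simp only [hX_def]; rw [if_neg (by omega)]
  have hgA1 : ∀ p : ℤ, 0 ≤ p → p ≤ (q:ℤ) - 2 * (h:ℤ) - 2 → g p = p + (q:ℤ) := by
    intros; simp only [hg_def]; split_ifs
    all_goals omega
  have hgA2 : ∀ p : ℤ, (q:ℤ) - 2 * (h:ℤ) - 2 ≤ p → p ≤ (q:ℤ) - 1 → g p = 2 * p + 2 * (h:ℤ) + 2 := by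
    intros; simp only [hg_def]; split_ifs
    all_goals omega
  have hgB : ∀ p : ℤ, (q:ℤ) ≤ p → p ≤ 2 * (q:ℤ) - 2 * (h:ℤ) - 2 → g p = p - (q:ℤ) := by
    intros; simp only [hg_def]; split_ifs
    all_goals omega
  have hgCe : ∀ s : ℤ, 0 ≤ s → s ≤ (h:ℤ) → g (2 * (q:ℤ) - 1 - 2 * s) = 3 * (q:ℤ) + (h:ℤ) - s := by
    intros; simp only [hg_def]; split_ifs
    all_goals omega
  have hgCo : ∀ s : ℤ, 0 ≤ s → s + 1 ≤ (h:ℤ) → g (2 * (q:ℤ) - 2 - 2 * s) = (q:ℤ) - (h:ℤ) - 2 - s := by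
    intros; simp only [hg_def]; split_ifs
    all_goals omega
  have hgDo : ∀ s : ℤ, 0 ≤ s → s + 1 ≤ (h:ℤ) → g (2 * (q:ℤ) + 2 * s + 1) = 3 * (q:ℤ) + (h:ℤ) + 1 + s := by
    intros; simp only [hg_def]; split_ifs
    all_goals omega
  have hgDe : ∀ s : ℤ, 0 ≤ s → s ≤ (h:ℤ) → g (2 * (q:ℤ) + 2 * s) = (q:ℤ) - (h:ℤ) - 1 + s := by
    intros; simp only [hg_def]; split_ifs
    all_goals omega
  have hgE : ∀ p : ℤ, 2 * (q:ℤ) + 2 * (h:ℤ) + 1 ≤ p → p ≤ 3 * (q:ℤ) - 1 → g p = p + (q:ℤ) := by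
    intros; simp only [hg_def]; split_ifs
    all_goals omega
  have hgF1 : ∀ p : ℤ, 3 * (q:ℤ) ≤ p → p ≤ 3 * (q:ℤ) + 2 * (h:ℤ) + 1 → g p = 2 * p - 4 * (q:ℤ) - 2 * (h:ℤ) - 1 := by
    intros; simp only [hg_def]; split_ifs
    all_goals omega
  have hgF2 : ∀ p : ℤ, 3 * (q:ℤ) + 2 * (h:ℤ) + 1 ≤ p → p ≤ 4 * (q:ℤ) - 1 → g p = p - (q:ℤ) := by
    intros; simp only [hg_def]; split_ifs
    all_goals omega
  -- tightness + involution, pairs, diagonal (abstract files)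
  have MT := fun (p : ℤ) (h0 : 0 ≤ p) (h1 : p ≤ 4 * (q:ℤ) - 1) =>
    morph_tight (q:ℤ) (h:ℤ) hqz hhz f X g hf1e hf1o hf2 hf3 hf4 hf5 hxL hxR hgA1 hgA2 hgB hgCe hgCo hgDo hgDe hgE hgF1 hgF2 p h0 h1
  have MP := fun (a b : ℤ) (ha0 : 0 ≤ a) (ha1 : a ≤ 4 * (q:ℤ) - 1) (hb0 : 0 ≤ b) (hb1 : b ≤ 4 * (q:ℤ) - 1) (hab : a ≠ b) =>
    morph_pair (q:ℤ) (h:ℤ) hqz hhz f X g hf1e hf1o hf2 hf3 hf4 hf5 hxL hxR hgA1 hgA2 hgB hgCe hgCo hgDo hgDe hgE hgF1 hgF2 a b ha0 ha1 hb0 hb1 hab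
  have MD := fun (x : ℤ) (hx0 : 0 ≤ x) (hx1 : x ≤ 2 * (q:ℤ) - 1) =>
    morph_feasible_diag (q:ℤ) (h:ℤ) hqz hhz f hf1e hf1o hf2 hf3 hf4 hf5 x hx0 hx1
  have hXrange : ∀ p : ℤ, 0 ≤ p → p ≤ 4 * (q:ℤ) - 1 → 0 ≤ X p ∧ X p ≤ 2 * (q:ℤ) - 1 := by
    intro p h0 h1; simp only [hX_def]; split_ifs
    all_goals constructor <;> omega
  -- the permutation
  let m := 2 * q + 2 * q
  have hbz : ∀ b : Fin m, (0:ℤ) ≤ (b:ℤ) ∧ ((b:ℕ):ℤ) ≤ 4 * (q:ℤ) - 1 := fun b => by have := b.isLt; constructor <;> omega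
  let tf : Fin m → Fin m := fun b => ⟨(g (b:ℤ)).toNat, by
    have h0 := (MT (b:ℤ) (hbz b).1 (hbz b).2).2.1
    have h1 := (MT (b:ℤ) (hbz b).1 (hbz b).2).2.2.1
    have := Int.toNat_of_nonneg h0
    omega⟩
  have htfz : ∀ b : Fin m, ((tf b : Fin m) : ℤ) = g (b:ℤ) := fun b => by
    show (((g (b:ℤ)).toNat : ℕ) : ℤ) = g (b:ℤ)
    exact Int.toNat_of_nonneg (MT (b:ℤ) (hbz b).1 (hbz b).2).2.1
  have hinv : ∀ b : Fin m, tf (tf b) = b := fun b => by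
    apply Fin.ext
    have e1 := htfz (tf b)
    have e2 := htfz b
    have e3 := (MT (b:ℤ) (hbz b).1 (hbz b).2).2.2.2
    rw [e2] at e1; rw [e3] at e1
    exact_mod_cast e1
  let τ : Equiv.Perm (Fin m) := ⟨tf, tf, hinv, hinv⟩
  have hτz : ∀ b : Fin m, ((τ b : Fin m) : ℤ) = g (b:ℤ) := htfz
  have hτsz : ∀ a : Fin m, ((τ.symm a : Fin m) : ℤ) = g (a:ℤ) := htfz
  refine ⟨τ, ?_, ?_, ?_⟩
  · have e := hτz ⟨q - 1, by omega⟩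
    have hgq : g ((q:ℤ) - 1) = 2 * (q:ℤ) + 2 * (h:ℤ) := by
      simp only [hg_def]; split_ifs
      all_goals omega
    have hc : (((⟨q - 1, by omega⟩ : Fin m) : ℕ) : ℤ) = (q:ℤ) - 1 := by show ((q - 1 : ℕ) : ℤ) = _; omega
    rw [hc, hgq] at e
    exact_mod_cast e
  · have e := hτz ⟨q, by omega⟩
    have hgq : g (q:ℤ) = 0 := by
      simp only [hg_def]; split_ifs
      all_goals omega
    have hc : (((⟨q, by omega⟩ : Fin m) : ℕ) : ℤ) = (q:ℤ) := by show ((q : ℕ) : ℤ) = _; rfl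
    rw [hc, hgq] at e
    exact_mod_cast e
  -- uniqueness of the optimum: weak duality with the rank function
  let w : Fin m → Fin m → ℤ := fun a b => |(a:ℤ) - (b:ℤ)| * ((4 * (q:ℤ) + 4 * (h:ℤ) + 3) - 2 * |(a:ℤ) - (b:ℤ)|)
  let Pt : Fin m → ℤ := fun v => ((8)*(h:ℤ)*(q:ℤ) + (2)*(q:ℤ)^2 + (4)*(q:ℤ) + (1)) - 2 * f (X (v:ℤ))
  let R : Fin m → ℤ := fun v => (4 * X (v:ℤ) - (4 * (q:ℤ) + 4 * (h:ℤ) + 1)) ^ 2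
  have hfeas : ∀ a b : Fin m, 2 * w a b ≤ Pt a + Pt b := by
    intro a b
    by_cases hab : a = b
    · subst hab
      have hd := MD (X (a:ℤ)) (hXrange _ (hbz a).1 (hbz a).2).1 (hXrange _ (hbz a).1 (hbz a).2).2
      simp only [w, Pt, sub_self, abs_zero, zero_mul, mul_zero]
      linarith
    · have hab' : ((a:ℕ):ℤ) ≠ ((b:ℕ):ℤ) := fun e => hab (Fin.ext (by exact_mod_cast e))
      have hp := (MP (a:ℤ) (b:ℤ) (hbz a).1 (hbz a).2 (hbz b).1 (hbz b).2 hab').1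
      simp only [w, Pt]
      linarith
  have htight : ∀ b : Fin m, 2 * w (τ b) b = Pt (τ b) + Pt b := by
    intro b
    have ht := (MT (b:ℤ) (hbz b).1 (hbz b).2).1
    simp only [w, Pt, hτz b]
    linarith
  have hrank : ∀ a b : Fin m, 2 * w a b = Pt a + Pt b → a = τ b ∨ R (τ.symm a) < R b := by
    intro a b heq
    by_cases hab : a = b
    · exfalso
      subst hab
      have hd := MD (X (a:ℤ)) (hXrange _ (hbz a).1 (hbz a).2).1 (hXrange _ (hbz a).1 (hbz a).2).2
      simp only [w, Pt, sub_self, abs_zero, zero_mul, mul_zero] at heq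
      linarith
    · have hab' : ((a:ℕ):ℤ) ≠ ((b:ℕ):ℤ) := fun e => hab (Fin.ext (by exact_mod_cast e))
      have hp := (MP (a:ℤ) (b:ℤ) (hbz a).1 (hbz a).2 (hbz b).1 (hbz b).2 hab').2
      simp only [w, Pt] at heq
      rcases hp (by linarith) with h1 | h1
      · left
        apply Fin.ext
        have e := hτz b
        rw [← h1] at e
        exact_mod_cast e.symm
      · right
        simp only [R, hτsz a]
        exact h1
  exact unique_opt_of_potential_rank w τ Pt R hfeas htight hrank

end Summit.ValiantsHypothesis.ValiantsHypothesis.Theorems.KPlusLogSqLaw.Toeplitz
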